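import Summits.BirchSwinnertonDyer.Rank1Residual.F1Sign2.DefiniteMod2WaldspurgerGaussianEdgeAtTwo
import Literature.NumberTheory.EllipticCurves.SupersingularAtTwoDiscriminantModEight
import HarnessLib

/-!
# AN-43 §32 kernel (typer -ty g22): REF1-AUDIT §314 probes for `F1Sign2/DefiniteMod2WaldspurgerGaussianEdgeAtTwo.lean` (-an g29 `section V14`, crux workfile 396c4b891ecaf77d)

CONTENT (all PROVED, no `sorry`, no `def`): -an's V14 has no glue theorems; this sibling carries REF1 §314's kernel facts (`REF1-data/b314/block314.lean` 109a4c08917a920e, VERBATIM):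
`two_mul_smul_periodLattice_le` / `uniformize_two_mul` (the constructible half of the KILL witness `Dt ↦ [2]∘Dt`: `ModularParametrizationData` does not pin the parametrisation),
`padicValNat_four_mul`, `padicValInt_two_mul`, `primed_invariant` (the REPAIRED bookkeeping `+ 2·v₂(c_f)` is invariant under `(deg, c) ↦ (4deg, 2c)`, the typed one is not),
`padicValInt_eq_zero_of_sq_eq_one` (optimal curve: primed = typed), the e-table `example`, `edgeTamagawaAtN_of_odd` / `padicValNat_edgeTamagawaAtN_of_odd` (R314e: `C_N = m`,
`v₂ = 0` on the family), `ss_family` + `edgeTwoExponent_eq_one_of_neg_of_five` ((Θ-ss-5) ⟹ `e = 1` on the supersingular class), `oct_of_fe` + **`octant_of_functionalEquation :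
EdgeThetaFunctionalEquation → EdgeThetaOctant`** (R314d).  NOT re-homed: the three kill theorems (need the unported as-typed rows).  BSD is not proved; 23715/22298 not closed.
-/

namespace Summit.BirchSwinnertonDyer.Rank1Residual.F1Sign2.ANg25.Kernel

open Literature.NumberTheory.Automorphic Literature.NumberTheory.Automorphic.Brandt
open Literature.NumberTheory.EllipticCurves
open scoped NumberField nonZeroDivisors Pointwise

/-! ### REF1-AUDIT §314 block (`REF1-data/b314/block314.lean` 109a4c08917a920e; theorems/examples VERBATIM minus the three kill theorems `shaFormula_deg_rigid`, `shaFormula_false_of_two_data`, `selmerCriterion_false_of_two_data` (they need the KILLED as-typed rows, which are not in the tree) and minus REF1's primed `def`s (ported as the rows' bodies in the parent); typer -ty g22) -/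
section REF1_314
open Literature.NumberTheory.EllipticCurves.ModularForms

/-- The `Dt ↦ Dt'` half that IS constructible here without the fibre count: doubling the Manin constant keeps
`c·Λ_f ⊆ Λ_E` (the only field constraining `c` besides `deg_spec`). -/
theorem two_mul_smul_periodLattice_le {W : WeierstrassCurve ℚ} {N : ℕ} [NeZero N]
    (Dt : ModularParametrizationData W N) :
    ∀ z ∈ periodLattice Dt.f, (((2 * Dt.c : ℤ)) : ℂ) * z ∈ Dt.L.lattice := by
  intro z hz
  have h := Dt.smul_periodLattice_le z hz
  have : (((2 * Dt.c : ℤ)) : ℂ) * z = (Dt.c : ℂ) * z + (Dt.c : ℂ) * z := by push_cast; ring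
  rw [this]
  exact add_mem h h

/-- and the `[2]`-composition on the uniformisation side: `uniformize (2c·I) = uniformize (c·I) + uniformize (c·I)`. -/
theorem uniformize_two_mul {W : WeierstrassCurve ℚ} {N : ℕ} [NeZero N]
    (Dt : ModularParametrizationData W N) (I : ℂ) :
    Dt.uniformize ((((2 * Dt.c : ℤ)) : ℂ) * I) = Dt.uniformize ((Dt.c : ℂ) * I) + Dt.uniformize ((Dt.c : ℂ) * I) := by
  rw [← map_add]; congr 1; push_cast; ring

/-- arithmetic of the witness: `v₂(4·deg) = v₂(deg) + 2`, `v₂(2c) = v₂(c) + 1`. -/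
theorem padicValNat_four_mul (d : ℕ) (hd : d ≠ 0) : padicValNat 2 (4 * d) = padicValNat 2 d + 2 := by
  rw [show (4 : ℕ) = 2 ^ 2 by norm_num, padicValNat.mul (by positivity) hd, padicValNat.prime_pow]; ring

/-- `v₂(2c) = v₂(c) + 1` (REF1 K314, witness arithmetic). -/
theorem padicValInt_two_mul (c : ℤ) (hc : c ≠ 0) : padicValInt 2 (2 * c) = padicValInt 2 c + 1 := by
  have h2 : padicValInt 2 2 = 1 := by
    have := @padicValInt.self 2 (by norm_num)
    simpa using this
  rw [padicValInt.mul (by norm_num) hc, h2]; ring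

/-- the primed bookkeeping is invariant under the witness `(deg, c) ↦ (4·deg, 2c)`; the typed one is not. -/
theorem primed_invariant (d : ℕ) (c : ℤ) (hd : d ≠ 0) (hc : c ≠ 0) (K : ℕ) :
    ((padicValNat 2 (4 * d) = K + 2 * padicValInt 2 (2 * c)) ↔ (padicValNat 2 d = K + 2 * padicValInt 2 c)) ∧
      padicValNat 2 (4 * d) ≠ padicValNat 2 d := by
  rw [padicValNat_four_mul d hd, padicValInt_two_mul c hc]; constructor <;> omega

/-- for the optimal curve (`c_f = ±1`) primed = typed. -/
theorem padicValInt_eq_zero_of_sq_eq_one (c : ℤ) (hc : c ^ 2 = 1) : padicValInt 2 c = 0 := by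
  have hu : IsUnit c := IsUnit.of_pow_eq_one hc two_ne_zero
  rcases Int.isUnit_iff.mp hu with rfl | rfl <;> simp [padicValInt]

/-! ### e-table / `C_N` / (Θ-ss-5) in the family / (Θ-FE) ⟹ (Θ-oct) — kernel checks on the REAL defs -/

example : edgeTwoExponent 1 443 = 3 ∧ edgeTwoExponent (-1) 79 = 2 ∧ edgeTwoExponent 1 (-431) = 2 ∧
    edgeTwoExponent (-1) (-43) = 1 ∧ edgeTwoExponent 0 (-67) = 1 ∧ edgeTwoExponent 2 (-3) = 1 ∧
    edgeTwoExponent 0 5 = 2 ∧ ((-431 : ℤ) % 8) = 1 ∧ ((-43 : ℤ) % 8) = 5 ∧ ((-1 : ℤ) % 2) = 1 := by decide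

/-- R314e: for odd `m` the `gcd` branch is inert and `C_N = m` (REF1 K314). -/
theorem edgeTamagawaAtN_of_odd (N m : ℕ) (hm : Odd m) : edgeTamagawaAtN N m = m := by
  unfold edgeTamagawaAtN
  split_ifs with h
  · rfl
  · have : Nat.gcd 2 m = 1 := (Nat.coprime_two_left.mpr hm).gcd_eq_one
    rw [this, Nat.mul_one]

/-- R314e: `v₂(C_N) = 0` for odd `m` (REF1 K314). -/
theorem padicValNat_edgeTamagawaAtN_of_odd (N m : ℕ) (hm : Odd m) : padicValNat 2 (edgeTamagawaAtN N m) = 0 := by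
  rw [edgeTamagawaAtN_of_odd N m hm]
  apply padicValNat.eq_zero_of_not_dvd
  obtain ⟨k, rfl⟩ := hm
  omega

/-- (Θ-ss-5)'s consequence in the family: `Δ = u·N^m ≡ 5 (8)`, `N ≡ 3 (4)`, `m` odd ⟹ `u = -1` and `N ≡ 3 (8)`. -/
theorem ss_family (N m : ℕ) (u : ℤˣ) (hN : N % 4 = 3) (hm : Odd m)
    (h : ((u : ℤ) * (N : ℤ) ^ m) % 8 = 5) : (u : ℤ) = -1 ∧ N % 8 = 3 := by
  have h8 : N % 8 = 3 ∨ N % 8 = 7 := by omega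
  have hsq : N ^ 2 % 8 = 1 := by
    rcases h8 with h8 | h8 <;> simp [Nat.pow_mod, h8]
  obtain ⟨k, rfl⟩ := hm
  have hpow : ∀ k : ℕ, N ^ (2 * k + 1) % 8 = N % 8 := by
    intro k
    induction k with
    | zero => simp
    | succ k ih =>
      rw [show 2 * (k + 1) + 1 = (2 * k + 1) + 2 by ring, pow_add, Nat.mul_mod, ih, hsq]
      simp
  have hc : ((N : ℤ) ^ (2 * k + 1)) % 8 = ((N ^ (2 * k + 1) % 8 : ℕ) : ℤ) := by norm_cast
  have hx : ((N : ℤ) ^ (2 * k + 1)) % 8 = 3 ∨ ((N : ℤ) ^ (2 * k + 1)) % 8 = 7 := by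
    rw [hc, hpow k]; rcases h8 with h8 | h8 <;> simp [h8]
  set x : ℤ := (N : ℤ) ^ (2 * k + 1) with hxdef
  rcases Int.units_eq_one_or u with rfl | rfl
  · exfalso
    simp only [Units.val_one, one_mul] at h
    omega
  · simp only [Units.val_neg, Units.val_one, neg_mul, one_mul] at h
    refine ⟨by simp, ?_⟩
    have hx3 : x % 8 = 3 := by omega
    rw [hc, hpow k] at hx3
    exact_mod_cast hx3

/-- hence `e = 1` on the supersingular class of the family (`a₂` even forces `Δ % 8 = 5`, so `Δ < 0`). -/
theorem edgeTwoExponent_eq_one_of_neg_of_five (a₂ Δ : ℤ) (hΔ : Δ < 0) (h5 : Δ % 8 = 5) :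
    edgeTwoExponent a₂ Δ = 1 := by
  unfold edgeTwoExponent
  rw [if_neg (by omega), if_neg (by omega)]

/-- (Θ-FE) ⟹ (Θ-oct), literally on the typed index shapes: a signed cyclic functional equation at level 3 forces the
octant condition, for either sign and every shift. -/
theorem oct_of_fe (c : ℕ → ℤ) (σ : ℤ) (hσ : σ = 1 ∨ σ = -1) (j₀ : ℕ) (hj₀ : j₀ < 4)
    (h : ∀ j : ℕ, j < 4 → c ((4 - j) % 4) = σ * c ((j + 4 - j₀) % 4)) :
    (c 0 - c 2) ^ 2 = (c 1 - c 3) ^ 2 ∨ (c 0 - c 2) * (c 1 - c 3) = 0 := by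
  have h0 := h 0 (by norm_num)
  have h1 := h 1 (by norm_num)
  have h2 := h 2 (by norm_num)
  have h3 := h 3 (by norm_num)
  interval_cases j₀ <;> rcases hσ with rfl | rfl <;> norm_num at h0 h1 h2 h3
  · right; rw [h1]; ring
  · right; have e0 : c 0 = 0 := by linarith
    have e2 : c 2 = 0 := by linarith
    rw [e0, e2]; ring
  · left; rw [h0, h2]; ring
  · left; rw [h0, h2]; ring
  · right; rw [h0]; ring
  · right; have e3 : c 3 = 0 := by linarith
    have e1 : c 1 = 0 := by linarith
    rw [e1, e3]; ring
  · left; rw [h0, h2]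
  · left; rw [h0, h2]; ring

/-- so `EdgeThetaFunctionalEquation → EdgeThetaOctant` (the docstring's claim), with the sign `(-1)^{r_an} ∈ {±1}`. -/
theorem octant_of_functionalEquation (h : EdgeThetaFunctionalEquation) : EdgeThetaOctant := by
  intro W _ _ N _ hN hN4 hcN k _ _ hk hdk i₀ hi 𝔭 h𝔭 S _ φ ψ I hI hφ hE J₀ hJ
  obtain ⟨j₀, hj₀, -, hfe⟩ := h W N hN hN4 hcN k hk hdk i₀ hi 𝔭 h𝔭 S φ ψ I hI hφ hE J₀ hJ
  have hσ : ((-1 : ℤ) ^ W.analyticRank = 1) ∨ ((-1 : ℤ) ^ W.analyticRank = -1) := by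
    rcases Nat.even_or_odd W.analyticRank with he | ho
    · exact Or.inl he.neg_one_pow
    · exact Or.inr ho.neg_one_pow
  exact oct_of_fe (fun j => edgeThetaCoeff S.O φ ψ i₀ 3 J₀ j) _ hσ j₀ hj₀ hfe

end REF1_314

/-! ### (Θ-ss-5) DISCHARGED (typer -ty g22): `SupersingularAtTwoDiscriminantModEight` is a THEOREM — Literature
`EllipticCurves/SupersingularAtTwoDiscriminantModEight.lean` (Serre 1972 §1.11 read on the minimal equation: `a₁` even via a rational
2-torsion point over `𝔽₂` when `ā₁ = 1`; ring identity `Δ + 27 b₆² ∈ 8ℤ` for even `a₁`; odd square `≡ 1 (mod 8)`), REF1 §314 R314c served -/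

/-- **(Θ-ss-5) holds.**  From the row's binders: `N` odd and `conductorNorm = N` ⟹ good reduction at `2`
(`hasGoodReductionAtPrime_of_not_dvd_conductorNorm'`); `a₂ % 2 = 0` ⟹ `2 ∣ a₂`; `Δ = u·N^m` is the (minimal) discriminant of the globally minimal
equation; conclude by `intCast_Δ_emod_eight_eq_five_of_two_dvd_frobeniusTrace_two`. -/
theorem supersingularAtTwoDiscriminantModEight_holds : SupersingularAtTwoDiscriminantModEight := by
  intro W _ _ N _ hN hN2 hcond m u hΔ hss
  haveI : Fact (Nat.Prime 2) := ⟨Nat.prime_two⟩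
  have hgood : W.HasGoodReductionAtPrime 2 := by
    refine W.hasGoodReductionAtPrime_of_not_dvd_conductorNorm' (ℓ := 2) ?_
    rw [hcond]; omega
  have heven : (2 : ℤ) ∣ W.frobeniusTrace 2 := Int.dvd_of_emod_eq_zero hss
  have hD : W.Δ = (((u : ℤ) * (N : ℤ) ^ m : ℤ) : ℚ) := by rw [hΔ]; push_cast; ring
  exact intCast_Δ_emod_eight_eq_five_of_two_dvd_frobeniusTrace_two W hgood heven hD

/-- Hence `e = 1` on the whole supersingular class of the family, unconditionally (REF1 K314 `ss_family` + `edgeTwoExponent_eq_one_of_neg_of_five`):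
for `W` as in (Θ-ss-5) with `N ≡ 3 (mod 4)` and `m` odd, `a₂` even ⟹ `u = −1`, `N ≡ 3 (mod 8)` and `edgeTwoExponent a₂ (u·N^m) = 1`. -/
theorem edgeTwoExponent_eq_one_of_supersingular (W : WeierstrassCurve ℚ) [W.IsElliptic] [W.IsGloballyMinimal] (N : ℕ) [NeZero N]
    (hN : N.Prime) (hN4 : N % 4 = 3) (hcond : W.conductorNorm ℤ = N) (m : ℕ) (u : ℤˣ) (hm : Odd m)
    (hΔ : W.Δ = ((u : ℤ) : ℚ) * (N : ℚ) ^ m) (hss : W.frobeniusTrace 2 % 2 = 0) :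
    (u : ℤ) = -1 ∧ N % 8 = 3 ∧ edgeTwoExponent (W.frobeniusTrace 2) ((u : ℤ) * (N : ℤ) ^ m) = 1 := by
  have h5 := supersingularAtTwoDiscriminantModEight_holds W N hN (by omega) hcond m u hΔ hss
  obtain ⟨hu, hN8⟩ := ss_family N m u hN4 hm h5
  refine ⟨hu, hN8, edgeTwoExponent_eq_one_of_neg_of_five _ _ ?_ h5⟩
  rw [hu]
  have hNpos : (0 : ℤ) < (N : ℤ) := by exact_mod_cast hN.pos
  have : (0 : ℤ) < (N : ℤ) ^ m := pow_pos hNpos m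
  linarith

end Summit.BirchSwinnertonDyer.Rank1Residual.F1Sign2.ANg25.Kernel
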